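import Summits.QuantumFields.YangMills.Theorems.AllWindowsColdBoxBoxHighLineSmearedFPOperator
import Summits.QuantumFields.YangMills.Theorems.AllWindowsColdBoxBoxHighLineSmearedFPPauli
import Summits.QuantumFields.YangMills.Theorems.AllWindowsColdBoxBoxHighLineSmearedFPOrbit

/-!
# T-S5.4J (task statements, planner ym-idea-2 g18): the orbit normaliser in JACOBIAN FORM — `OrbitNormaliserJacobian`
# and its bricks J1 `OrbitMapJacobianDet`, J2 `OrbitMapContraction`, J4 `OrbitMapBulkSurj`, J5a `FarRegionPhiLowerBall`, J5b `FPDetCrude`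

STEP (1b)/(1c) of S5 (LINE-19 `stub_landauSecondOrder`, θ_L ≤ 1/13) — «FP/Haar change of variables» of S5's own text, done EXACTLY.
This file SUPERSEDES the Laplace-of-`N_h` target of `STUB-PLAN-S5U5-STEP1c.md` §0 (`OrbitNormaliserLaplace`, never typed), for the
reason recorded on the seat's bus 2026-08-29T18:11Z («ROUTING DECISION»):

* PRECISION COUNT. S5 needs every correction RELATIVE to the `T⁻⁸` main term of `β²·boxPlaqCov` (T up to H), i.e. an unstructured
  density factor `(1 + R(U))⁻¹` in the FP representation must have `sup |R| = R_* ≪ η·H⁻⁸`.  The sup-box Laplace sandwich of STEP1c §2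
  delivers `R_* ≍ ρ²·n'·(log H)⁴ = H⁻⁶(log H)⁴` at `ρ = c'/H⁵` (θ < 1/14 only), and the natural `O(H⁴·polylog/β)` is not reachable by
  domination on a sup-box.  The Jacobian form below delivers `R_* = e^{−c·H⁴}`.
* THE MOVE. Insert into the smeared FP identity ✓T-S5.1 (`smearedFPIdentity`) the JACOBIAN-WEIGHTED weight
  `h_J(W) = exp(−β·landauPhi H W) · ballCutoff H r W · |det (fpOperator H W)|` (`jacWeight`; the FP determinant AT THE CONFIGURATION — the
  textbook BRST form).  In the Pauli chart (✓T-S5.4b `orbitAveragePauli`, fcl-p3's 4k-C `orbitAverage_eq_flat`) the Haar density times the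
  inserted determinant IS the Jacobian of the orbit map `Ψ_V(A) = ♭ divDefect(V^{pauliGauge A})` (J1, from ✓Literature
  `B10Eq18SigmaSU2Haar.sigmaSU2_eq_sigma0_mul_det_jac`, `B13HaarSigmaJacobian.hasFDerivAt_expChart_right`, `det_jac_su2`):
  `Π_x σ(‖A_x‖) · |det F(V^{pauliGauge A})| = (2π²)^{−n'} · |det DΨ_V(A)|`, so `N_J(V) = (2π²)^{−n'} ∫ |det DΨ_V| e^{−β|Ψ_V|²} χ dA`, and the
  EQUAL-DIMENSION change of variables `c = Ψ_V(A)` (✓Literature `B10Eq18ChangeOfVariables.eq18_substitution_integral` / `eq18_su2`, or Mathlib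
  `integral_image_eq_integral_abs_det_fderiv_smul`; injectivity on the sup-box `S₀ = {‖A_x‖ ≤ a₀ ≍ H⁻²}` by `injOn_id_sub_of_nnnorm_fderiv_le` and J2)
  turns the bulk into the Gaussian `∫ e^{−β|c|²} dc = (π/β)^{3n'/2}` (✓4a).  UPPER: `N_J ≤ Z₀ + FAR`, `FAR ≤ e^{C·n'·log n' − c′β/H⁸}` (J5a far-region
  coercivity on `supp χ ∖ S₀` = ✓4ℓ + ✓4j, and J5b).  LOWER: `N_J ≥ Z₀(1 − e^{−c·n'})` by SURJECTIVITY of `Ψ_V` from the smaller box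
  `S₁ = {‖A_x‖ ≤ a₁ ≍ 1/(H⁴(1+log β)²)}` (where `χ = 1`, w5's `bulkCutoffOne`) onto the Gaussian bulk `{|c|₂² ≤ 6n'/β}` (J4: Banach fixed point of
  `A ↦ A − F_V⁻¹(Ψ_V(A) − c)`; ℓ²-contraction by J2, sup-norm self-map by the row norms ✓4i-a/✓4v) and the norm tail ✓4m `gaussianNormTail`.
* NET. `|N_J(V)/Z₀ − 1| ≤ e^{−c·H⁴}` uniformly in small Landau `V`, in the window `C·H¹²·(1+log β)⁸ ≤ β` (θ < 1/12: EXACTLY LINE-19's range;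
  binding constraints: bulk-inside-injectivity-box `H⁶·polylog ≤ √β` and far-region payment `β/H⁸ ≫ H⁴ log β`).  The determinant `|det F(U)|`
  moves into the effective action, where ✓4r `logDetSecondOrder` (w2) expands it as the ghost loop in S5 proper.
* HONEST FLAGS. `U5-window` OPEN: U5 (LINE-20, θ ≤ 1/11 > 1/12) is NOT served as counted (needs the ℓ²/ℓ^∞ sharpening of the two binding
  constraints; U5 is unstaffed anyway, prereg N2/I23).  The V-dependence of `R` is irrelevant here (it is exponentially small), which removes
  STEP1b §4–5's «Lipschitz-in-V» task.  4k-A/4k-B (Laplace sandwich), 4g, 4h are BANKED (unused by T-S5.4J; possibly useful for S5-proper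
  moment bounds); 4k-C, 4a, 4m, 4ℓ, 4j, 4p/4q, 4c/4c-E, 4f, 4i-a/4v, T-S5.1/5.4b stay LOAD-BEARING.

All operator norms below are ℓ² (dotProduct form) on the flat coordinate space `ι = ↥(interiorSites H) × Fin 3 → ℝ`; the builder runs eq18 on
`EuclideanSpace ℝ ι` via `WithLp`/`flatten` (measure-preserving).  Constants are existential; provers choose them.

HONEST LABEL: task STATEMENTS (Props + three auxiliary defs) for step (1b)/(1c) of the XL stubs S5/U5 of critic-PASSed DRAFT lines;
T-S5.4J, S5, U5, ⟨stmt-QuantumFields-24004⟩ ⟨24335⟩ ⟨24336⟩ OPEN; route AllWindowsColdBox DRAFT; the YM mass gap is NOT proved by any of this;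
no summit is proved by a line.
-/

set_option autoImplicit false

noncomputable section

open MeasureTheory Matrix Finset
open Literature.MathematicalPhysics.QuantumFieldTheory.AxialGauge (boxEdges)
open Literature.MathematicalPhysics.QuantumFieldTheory.Balaban1983to89.B10Eq22Rescaling (sigmaSU2)
open Literature.MathematicalPhysics.QuantumLattice (gaugeTransformZd LGConfig)
open Literature.Probability.LatticeModels (Site)

namespace Summit.QuantumFields.YangMills.Theorems.AllWindowsColdBoxBoxHighLine

/-! ## The three objects -/

/-- **The Jacobian-weighted smeared gauge-fixing weight** `h_J(W) = exp(−β·Φ(W)) · χ_r(W) · |det F_FP(W)|` — ✓`fpWeight` times the absolute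
Faddeev–Popov determinant of ✓`fpOperator` AT the configuration `W`.  Measurable, `≥ 0`, bounded (J5b), so ✓T-S5.1 applies to `h_J + ε`. -/
def jacWeight (β : ℝ) (H : ℕ) (r : ℝ) (W : LGConfig 4 SU2) : ℝ :=
  fpWeight β H r W * |(fpOperator H W).det|

/-- **The Gaussian constant** `Z₀(β,H) = (2π²)^{−n'} · (π/β)^{3n'/2}`, `n' = #interiorSites H` (= `(2H−1)⁴` for `H ≥ 1`). -/
def laplaceZ0 (β : ℝ) (H : ℕ) : ℝ :=
  ((2 * Real.pi ^ 2)⁻¹) ^ (interiorSites H).card * (Real.pi / β) ^ ((3 : ℝ) * (interiorSites H).card / 2)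

/-- **The orbit map in flat coordinates** `Ψ_V : ℝ^{I×3} → ℝ^{I×3}`, `v ↦ ((x,c) ↦ divDefect (V^{pauliGauge (♭⁻¹ v)}) x c)` — the gauge-fixing
function along the interior gauge orbit of `V` in the Pauli exponential chart (`♭⁻¹ = vecToField`, ✓SmearedFPOperator). -/
def orbitMapFlat (H : ℕ) (V : LGConfig 4 SU2) (v : ↥(interiorSites H) × Fin 3 → ℝ) : ↥(interiorSites H) × Fin 3 → ℝ :=
  fun p => divDefect (gaugeTransformZd (pauliGauge H (vecToField H v)) V) (p.1 : Site 4) p.2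

/-! ## The target -/

/-- **T-S5.4J `OrbitNormaliserJacobian` (M given J1–J5; builder fcl-p3).**  For `H ≥ 1`, `β ≥ 2` in the window `C·H¹²·(1+log β)⁸ ≤ β`,
a base point `V` in lattice Landau gauge with cold-box links within defect `r₀²` of the identity (`C·r₀·H² ≤ 1`), and a cut-off radius `r`
with `r₀ + 1/(C·H⁴·(1+log β)²) ≤ r` and `C·r·H ≤ 1`: the orbit average of the Jacobian-weighted weight is the Gaussian constant up to an
EXPONENTIALLY small relative error, `|N_J(V)/Z₀ − 1| ≤ exp(−c·H⁴)`. -/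
def OrbitNormaliserJacobian : Prop :=
  ∃ C c : ℝ, 0 < C ∧ 0 < c ∧ ∀ H : ℕ, 1 ≤ H → ∀ β r₀ r : ℝ, 2 ≤ β →
    C * (H : ℝ) ^ 12 * (1 + Real.log β) ^ 8 ≤ β →
    0 ≤ r₀ → C * r₀ * (H : ℝ) ^ 2 ≤ 1 →
    r₀ + 1 / (C * (H : ℝ) ^ 4 * (1 + Real.log β) ^ 2) ≤ r → C * r * H ≤ 1 →
    ∀ V : LGConfig 4 SU2, InLandauGauge H V → (∀ e ∈ boxEdges 4 (2 * H + 1), linkDefect V e ≤ r₀ ^ 2) →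
      |orbitAverage H (jacWeight β H r) V / laplaceZ0 β H - 1| ≤ Real.exp (-(c * (H : ℝ) ^ 4))

/-! ## The bricks -/

/-- **J1 `OrbitMapJacobianDet` (M; owner w3).**  The orbit map is differentiable everywhere and the absolute Jacobian determinant is the
Faddeev–Popov determinant at the moved configuration times the Haar chart density: `|det DΨ_V(v)| = |det F(V^{pauliGauge A})| · Π_x 2π²σ(‖A_x‖)`,
`A = ♭⁻¹v`.  Route: `pauliGauge (A + tB) = k_t · pauliGauge A` with `k_t(x) = expPauli(A_x + tB_x)·expPauli(A_x)⁻¹`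
(✓`extendGauge_mul`, ✓`gaugeTransformZd_gaugeTransformZd_eq` — the tree's action `g·U·g⁻¹` is a LEFT action), whose `t`-derivative at 0 is
`jac(−iA_x)(iB_x)` (✓`hasFDerivAt_expChart_right`); the derivative of `B' ↦ divDefect (W^{pauliGauge B'})` at `0` is `fpOperator H W` (w2's 4c
analytic half, little-o form); chain rule; `|det ⊕_x jac(−iA_x)| = Π_x (sin‖A_x‖/‖A_x‖)²` (✓`det_jac_su2`, `Matrix.det_blockDiagonal`)
`= Π_x 2π²·sigmaSU2 ‖A_x‖` (✓`sigmaSU2_eq_sigma0_mul_det_jac`). -/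
def OrbitMapJacobianDet : Prop :=
  ∀ (H : ℕ) (V : LGConfig 4 SU2) (v : ↥(interiorSites H) × Fin 3 → ℝ),
    DifferentiableAt ℝ (orbitMapFlat H V) v ∧
    |(fderiv ℝ (orbitMapFlat H V) v).det| =
      |(fpOperator H (gaugeTransformZd (pauliGauge H (vecToField H v)) V)).det| *
        ∏ x : ↥(interiorSites H), (2 * Real.pi ^ 2 * sigmaSU2 ‖vecToField H v x‖)

/-- **J2 `OrbitMapContraction` (M; owner w2).**  Quantitative closeness of `DΨ_V(v)` to the base operator `F_V = fpOperator H V` on a sup-box: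
for `V` with links within `r₀²` of the identity (`C·r₀·H² ≤ 1`, so `F_V` is invertible with `‖F_V⁻¹‖₂ ≤ 8H²` by w4's floors + 4c-E) and
`‖A_x‖ ≤ a ≤ 1` for all `x`: `‖(1 − F_V⁻¹·DΨ_V(v)) w‖₂ ≤ C·H²·a·‖w‖₂`.  Route: `DΨ_V(v) = F(V^{pauliGauge A})·⊕_x jac(−iA_x)` (J1's structure),
the two-configuration Lipschitz bound `‖F(W) − F(W')‖₂→₂ ≤ 84·max_e ‖W_e − W'_e‖` (4c-E's proof with `1 ↦ W'`; `F` is ℝ-linear in the links),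
`‖(V^{pauliGauge A})_e − V_e‖ ≤ 4‖A‖_∞`, `‖jac(iA) − 1‖ ≤ e^{2‖A‖} − 1`, `‖F(W)‖₂→₂ ≤ C`. -/
def OrbitMapContraction : Prop :=
  ∃ C : ℝ, 0 < C ∧ ∀ H : ℕ, 1 ≤ H → ∀ r₀ a : ℝ, 0 ≤ r₀ → 0 ≤ a → a ≤ 1 → C * r₀ * (H : ℝ) ^ 2 ≤ 1 →
    ∀ V : LGConfig 4 SU2, (∀ e ∈ boxEdges 4 (2 * H + 1), linkDefect V e ≤ r₀ ^ 2) →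
      IsUnit (fpOperator H V).det ∧
      ∀ v : ↥(interiorSites H) × Fin 3 → ℝ, (∀ x, ‖vecToField H v x‖ ≤ a) →
        ∀ w : ↥(interiorSites H) × Fin 3 → ℝ,
          (w - (fpOperator H V)⁻¹ *ᵥ (fderiv ℝ (orbitMapFlat H V) v w)) ⬝ᵥ
              (w - (fpOperator H V)⁻¹ *ᵥ (fderiv ℝ (orbitMapFlat H V) v w)) ≤
            (C * (H : ℝ) ^ 2 * a) ^ 2 * (w ⬝ᵥ w)

/-- **J4 `OrbitMapBulkSurj` (M; owner w4).**  Surjectivity of the orbit map from a small sup-box onto an ℓ²-ball: for `V` Landau (so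
`Ψ_V(0) = 0`, ✓`landauPhi_eq_zero_iff`) with links within `r₀²`, and `a, ρ ≥ 0` with `C·(r₀ + a)·H² ≤ 1`, `C·H⁴·a ≤ 1`,
`C·(1 + log H)²·ρ ≤ a`: every `c` with `|c|₂ ≤ ρ` is `Ψ_V(v)` for some `v` with all `‖(♭⁻¹v)_x‖ ≤ a`.  Route: Banach fixed point
(`ContractingWith.fixedPoint`) of `Γ_c(v) = v − F_V⁻¹(Ψ_V(v) − c)` on the closed sup-box (complete): ℓ²-Lipschitz constant `C·H²·a < 1` by J2 +
convexity (`Convex.lipschitzOnWith_of_nnnorm_hasFDerivWithin_le`); self-map since `‖Γ_c(v)_x‖ ≤ |Γ_c(v) − Γ_c(0)|₂ + ‖(F_V⁻¹c)_x‖ ≤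
C H² a·|v|₂ + (max row ℓ²-norm of F_V⁻¹)·ρ ≤ 4C H⁴ a² + C'(1+log H)² ρ ≤ a` (rows: ✓4i-a `dirichletGreenFrobeniusRow` + ✓4v `PerturbedInverseRows`). -/
def OrbitMapBulkSurj : Prop :=
  ∃ C : ℝ, 0 < C ∧ ∀ H : ℕ, 1 ≤ H → ∀ r₀ a ρ : ℝ, 0 ≤ r₀ → 0 ≤ a → 0 ≤ ρ →
    C * (r₀ + a) * (H : ℝ) ^ 2 ≤ 1 → C * (H : ℝ) ^ 4 * a ≤ 1 → C * (1 + Real.log H) ^ 2 * ρ ≤ a →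
    ∀ V : LGConfig 4 SU2, InLandauGauge H V → (∀ e ∈ boxEdges 4 (2 * H + 1), linkDefect V e ≤ r₀ ^ 2) →
      ∀ c : ↥(interiorSites H) × Fin 3 → ℝ, c ⬝ᵥ c ≤ ρ ^ 2 →
        ∃ v : ↥(interiorSites H) × Fin 3 → ℝ, (∀ x, ‖vecToField H v x‖ ≤ a) ∧ orbitMapFlat H V v = c

/-- **J5a `FarRegionPhiLowerBall` (S; owner w5) = 4q′.**  w5's `FarRegionPhiLower` with the ball condition on the MOVED configuration taken as a
HYPOTHESIS (in T-S5.4J it is read off `ballCutoff ≠ 0`, ✓`linkDefect_lt_of_ballCutoff_ne_zero`) instead of being derived from `‖A x‖ ≤ ρ₁`: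
✓4ℓ `landauBallCoercivity` with `U := V`, `g := 1`, `g' := pauliGauge H A`, then one term of the sum and ✓4j's lower half
`(2/π)²‖A x‖² ≤ gaugeDist 1 (pauliGauge H A) x` (`‖A x‖ ≤ π`). -/
def FarRegionPhiLowerBall : Prop :=
  ∃ c₀ c : ℝ, 0 < c₀ ∧ 0 < c ∧ ∀ H : ℕ, 1 ≤ H → ∀ r : ℝ, 0 ≤ r → r * H ≤ c₀ →
    ∀ (V : LGConfig 4 SU2) (A : ↥(interiorSites H) → EuclideanSpace ℝ (Fin 3)),
      InLandauGauge H V → (∀ e ∈ boxEdges 4 (2 * H + 1), linkDefect V e ≤ r ^ 2) →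
      (∀ e ∈ boxEdges 4 (2 * H + 1), linkDefect (gaugeTransformZd (pauliGauge H A) V) e ≤ r ^ 2) →
      (∀ x, ‖A x‖ ≤ Real.pi) →
        ∀ x₀ : ↥(interiorSites H), c * ‖A x₀‖ ^ 2 ≤ (H : ℝ) ^ 4 * landauPhi H (gaugeTransformZd (pauliGauge H A) V)

/-- **J5b `FPDetCrude` (S; owner w5 or w2).**  A crude uniform bound on the Faddeev–Popov determinant: the entries of `fpOperator H W` are bounded by
an absolute constant for EVERY `SU(2)`-valued `W` (each entry is a sum over ≤ 8 links of `imVecM (X·W_e − W_e·X)`, `X = su2Coord e_b`), hence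
`|det F(W)| ≤ (3n')!·C₁^{3n'} ≤ exp(C·n'·(1 + log n'))` (Mathlib `Matrix.det_le`). -/
def FPDetCrude : Prop :=
  ∃ C : ℝ, 0 < C ∧ ∀ (H : ℕ) (W : LGConfig 4 SU2),
    |(fpOperator H W).det| ≤ Real.exp (C * (interiorSites H).card * (1 + Real.log ((interiorSites H).card)))

/-! ## Sanity: the objects elaborate against the landed tree -/

example (β : ℝ) (H : ℕ) (r : ℝ) (W : LGConfig 4 SU2) : 0 ≤ jacWeight β H r W :=
  mul_nonneg (fpWeight_nonneg β H r W) (abs_nonneg _)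

end Summit.QuantumFields.YangMills.Theorems.AllWindowsColdBoxBoxHighLine

end
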